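import Literature.AlgebraicGeometry.Motives.GrassmannianChartTransition
import Literature.AlgebraicGeometry.Motives.GrassmannianClassifyQuotient
import Literature.AlgebraicGeometry.Motives.GrassmannianOneChartOverlap
import Literature.AlgebraicGeometry.Motives.GrassmannianChartSchemeRange
import Literature.AlgebraicGeometry.Modules.FrameTransition
import HarnessLib

/-!
# The tautological quotient on the charts of the Grassmannian: kernels of the sections maps, classifying map, overlaps

Topic `AlgebraicGeometry/Motives`; namespace `Literature.AlgebraicGeometry.Motives.Grassmannian`.  THEOREMS ONLY (no definition,
no instance, no notation, no named fact, no `sorry`).  Chart-side half (PATH C, FILE B) of the cell's (h4) brick (Q3) «the universal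
quotient on `grassmannianScheme M k`» (lead B-p21 (g16), PATH G); sequel of ★ (Q2) `GrassmannianClassifyQuotient` and ★ FILE A
`GrassmannianChartTransition` (the transition cocycle `g_{xy}`).
Setting ([GortzWedhorn2020, (8.4) (pp. 213–215)]): `b : J → M` a basis of the free abelian group `M`, `T` a scheme, `Q` an
`𝒪_T`-module with global sections `q_j` and sections maps `θ_V : Γ(T, V) ⊗ M → Γ(Q, V)`, `a ⊗ b_j ↦ a · q_j|_V` (★ `sectionsMap`);
a frame `e : 𝒪^ι ≅ Q|_W` (`ι : Type u` finite, `σ : ι ≃ Fin k`) over `W ⊇ V`; a section `y ∈ Gr(T)` whose affine evaluation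
`y|_V := evalAffine V y` lies in the chart of the frame `x : Fin k → M` (★ `GrassmannianCharts`), with chart coordinates
`coordMap x (y|_V) : M → Γ(T, V)^k` (★ `GrassmannianChartAffine`).  The TAUTOLOGICAL RELATION is
`(hq)  q_j|_V = Σ_i coordMap x (y|_V) (b_j)_{σ i} · e_i|_V` («the `q_j` are the images of `1 ⊗ b_j`, framed by the `[1 ⊗ x_i]`»).

* §1 (any `ψ : M → Γ(T, V)^ι` as coordinates) `coord_sectionsMap`, **`ker_sectionsMap_eq_ker_liftBaseChange`** (`ker θ_V = ker ψ̃`),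
  `sectionsMap_surjective_of_liftBaseChange_surjective`;
* §2 under (hq): **`ker_sectionsMap_eq_evalAffine`** (`ker θ_V = (y|_V).toSubmodule`, ★ `ker_liftBaseChange_coordMap`) and
  **`sectionsMap_surjective_of_tautological`** (the `hsurj` of ★ `existsUnique_hom_ker_sectionsMap`);
* §3 restriction to affine `V′ ≤ V` (glue-family / `map_g` form of the transition data): `coordMap_evalAffine_of_le`,
  `transition_evalAffine_of_le` (`g_{xx′}(y|_{V′}) = g_{xx′}(y|_V)|_{V′}`), `tautological_of_le`;
* §4 THE CHART INSTANCE on `Spec ℤ[X_I] = chartScheme k I`, `y := chartElem I` (★ `GrassmannianChartScheme`), any `Q₀` framed over `⊤`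
  with `q_j = Σ_i X-coordinates of b_j · e_i` (★ `chartCoordMap` read in `Γ(Spec ℤ[X_I], ⊤)`): `coordMap_evalAffine_top_chartElem`,
  **(B2) `ker_sectionsMap_chart`**, **(B1) `sectionsMap_chart_surjective`**, **(B3) `classify_chart_iff` / `existsUnique_classify_chart`**
  — the morphism classifying the tautological quotient IS the chart immersion `(pointsEquiv _).symm (chartElem I)`;
* §5 **(B0) `chartLocus_chartElem_eq_basicOpen_det`, `preimage_opensRange_chartι_eq_basicOpen_det`** — `U_I ∩ U_{I′}` pulled back to
  `Spec ℤ[X_{I′}]` is `D(det g_{I′I})` (★ `mem_chart_iff_isUnit_det_transition`; rank one ★ `chartLocus_one_chartElem_eq_basicOpen`),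
  hence **`isAffineOpen_opensRange_inf_opensRange`**: the pairwise overlaps of the standard cover of `grassmannianScheme M k` are affine.

[GortzWedhorn2020, (8.4) (pp. 213–215)] (the universal quotient of the Grassmannian and its charts); [StacksProject, Tag 089T / 089R];
[EisenbudHarris2016, §3.2.2]; [Hartshorne1977, II Ex. 5.18 (p. 128)] (transition data).  Cell `hodgecm-mathlib` (D-0151), count-neutral
Mathlib-side capital; nothing here is about HC — HC_CM is proved only modulo the 7 printed citations until rung 0 closes.
-/

noncomputable section
-- `TopCat.Presheaf`/`Scheme.Modules` are not reducible (as in Mathlib's `AlgebraicGeometry/Modules/Tilde.lean`).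
set_option backward.isDefEq.respectTransparency false
namespace Literature.AlgebraicGeometry.Motives.Grassmannian

open CategoryTheory Opposite TensorProduct TopologicalSpace _root_.AlgebraicGeometry
open Literature.AlgebraicGeometry.Modules

universe u
variable {k : ℕ} {M : Type u} [AddCommGroup M] {J : Type u} (b : Module.Basis J ℤ M)
variable {T : Scheme.{u}} (Q : T.Modules) (q : J → Γ(Q, ⊤))

/-! ## §1 Sections maps of a module framed over `V`, with prescribed coordinates of the `q_j` -/

section Framed

variable {ι : Type u} [Fintype ι] {W V : T.Opens} (e : SheafOfModules.free ι ≅ Q.over W) (kV : V ⟶ W)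
  (ψ : M →ₗ[ℤ] (ι → Γ(T, V)))
  (hq : ∀ j, Q.presheaf.map (homOfLE le_top).op (q j) = ∑ i, ψ (b j) i • Q.presheaf.map kV.op (basisSection e i))

include hq in
/-- If `q_j|_V = Σᵢ ψ(b_j)ᵢ · eᵢ|_V` for a `ℤ`-linear `ψ : M → Γ(T, V)^ι` and a frame `e` over `W ≥ V`, then
`θ_V (1 ⊗ m) = Σᵢ ψ(m)ᵢ · eᵢ|_V` for every `m ∈ M`. [cite: GortzWedhorn2020, (8.4) (pp. 213–215)] -/
theorem sectionsMap_one_tmul_eq_sum_smul (m : M) :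
    sectionsMap b Q q V ((1 : Γ(T, V)) ⊗ₜ[ℤ] m) = ∑ i, ψ m i • Q.presheaf.map kV.op (basisSection e i) := by
  let f₁ : M →ₗ[ℤ] Γ(Q, V) := (sectionsMap b Q q V).restrictScalars ℤ ∘ₗ TensorProduct.mk ℤ Γ(T, V) M 1
  let f₂ : M →ₗ[ℤ] Γ(Q, V) :=
    (Fintype.linearCombination Γ(T, V) fun i => Q.presheaf.map kV.op (basisSection e i)).restrictScalars ℤ ∘ₗ ψ
  have hf : f₁ = f₂ := by
    refine b.ext fun j => ?_
    change sectionsMap b Q q V ((1 : Γ(T, V)) ⊗ₜ[ℤ] b j) =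
      Fintype.linearCombination Γ(T, V) (fun i => Q.presheaf.map kV.op (basisSection e i)) (ψ (b j))
    rw [sectionsMap_one_tmul, hq j, Fintype.linearCombination_apply]
  have h := LinearMap.congr_fun hf m
  change sectionsMap b Q q V ((1 : Γ(T, V)) ⊗ₜ[ℤ] m) =
    Fintype.linearCombination Γ(T, V) (fun i => Q.presheaf.map kV.op (basisSection e i)) (ψ m) at h
  rw [h, Fintype.linearCombination_apply]

include hq in
/-- The coordinates in the frame `e` of `θ_V z` are `ψ̃(z)`, `ψ̃ = ψ.liftBaseChange Γ(T, V) : Γ(T, V) ⊗ M → Γ(T, V)^ι`.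
[cite: GortzWedhorn2020, (8.4) (pp. 213–215)] -/
theorem coord_sectionsMap (z : Γ(T, V) ⊗[ℤ] M) (i : ι) :
    coord e kV (sectionsMap b Q q V z) i = ψ.liftBaseChange Γ(T, V) z i := by
  induction z using TensorProduct.induction_on with
  | zero => rw [map_zero, map_zero, coord_zero, Pi.zero_apply]
  | tmul a m =>
    rw [sectionsMap_tmul, coord_smul, sectionsMap_one_tmul_eq_sum_smul b Q q e kV ψ hq m,
      coord_sum_smul_basisSection, LinearMap.liftBaseChange_tmul, Pi.smul_apply, smul_eq_mul]
  | add z z' hz hz' => rw [map_add, map_add, coord_add, hz, hz', Pi.add_apply]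

include hq in
/-- **The kernel of the sections map over a framed open is the kernel of `ψ̃`**:
`ker θ_V = ker (ψ.liftBaseChange Γ(T, V))`. [cite: GortzWedhorn2020, (8.4) (pp. 213–215)] -/
theorem ker_sectionsMap_eq_ker_liftBaseChange :
    LinearMap.ker (sectionsMap b Q q V) = LinearMap.ker (ψ.liftBaseChange Γ(T, V)) := by
  ext z
  rw [LinearMap.mem_ker, LinearMap.mem_ker]
  constructor
  · intro h
    funext i
    rw [← coord_sectionsMap b Q q e kV ψ hq z i, h, coord_zero, Pi.zero_apply]
  · intro h
    refine ext_of_coord e kV fun i => ?_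
    rw [coord_sectionsMap b Q q e kV ψ hq z i, h, coord_zero, Pi.zero_apply]

include hq in
/-- If `ψ̃` is surjective then so is `θ_V`. [cite: GortzWedhorn2020, (8.4) (pp. 213–215)] -/
theorem sectionsMap_surjective_of_liftBaseChange_surjective (hψ : Function.Surjective (ψ.liftBaseChange Γ(T, V))) :
    Function.Surjective (sectionsMap b Q q V) := by
  intro s
  obtain ⟨z, hz⟩ := hψ fun i => coord e kV s i
  refine ⟨z, ext_of_coord e kV fun i => ?_⟩
  rw [coord_sectionsMap b Q q e kV ψ hq z i, hz]

end Framed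

/-! ## §2 The tautological relation `q_j|_V = Σᵢ coordMap x (y|_V) (b_j)_{σ i} · eᵢ|_V` for a section `y ∈ Gr(T)` -/

/-- Proof-irrelevant congruence of the chart coordinates in the chart point. [cite: StacksProject, Tag 089T] -/
theorem coordMap_congr {R : Type*} [CommRing R] {M' : Type*} [AddCommGroup M'] [Module R M'] {A : Type*} [CommRing A]
    [Algebra R A] (x : Fin k → M') {N N' : Module.Grassmannian A (A ⊗[R] M') k} (h : N = N')
    (hN : N ∈ chart R M' k x A) (hN' : N' ∈ chart R M' k x A) : coordMap x N hN = coordMap x N' hN' := by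
  subst h
  rfl

section Tautological

variable {ι : Type u} [Fintype ι] (σ : ι ≃ Fin k) {W V : T.Opens} (e : SheafOfModules.free ι ≅ Q.over W) (kV : V ⟶ W)
  (hV : IsAffineOpen V) (y : (grassmannianSheaf M k).obj.obj (op T)) (x : Fin k → M)
  (hx : evalAffine hV y ∈ chart ℤ M k x Γ(T, V))
  (hq : ∀ j, Q.presheaf.map (homOfLE le_top).op (q j) =
    ∑ i, coordMap x (evalAffine hV y) hx (b j) (σ i) • Q.presheaf.map kV.op (basisSection e i))

omit [Fintype ι] in
/-- Reindexing `ψ ↦ (m ↦ ψ(m) ∘ σ)` does not change the kernel of the `A`-linear extension. [folklore] -/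
private theorem ker_liftBaseChange_funLeft_comp {A : Type u} [CommRing A] (φ : M →ₗ[ℤ] (Fin k → A)) :
    LinearMap.ker ((LinearMap.funLeft ℤ A σ ∘ₗ φ).liftBaseChange A) = LinearMap.ker (φ.liftBaseChange A) := by
  have key : ∀ z : A ⊗[ℤ] M, ∀ i, (LinearMap.funLeft ℤ A σ ∘ₗ φ).liftBaseChange A z i = φ.liftBaseChange A z (σ i) := by
    intro z i
    induction z using TensorProduct.induction_on with
    | zero => rw [map_zero, map_zero, Pi.zero_apply, Pi.zero_apply]
    | tmul a m =>
      rw [LinearMap.liftBaseChange_tmul, LinearMap.liftBaseChange_tmul, Pi.smul_apply, Pi.smul_apply,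
        LinearMap.comp_apply, LinearMap.funLeft_apply]
    | add z z' hz hz' => rw [map_add, map_add, Pi.add_apply, Pi.add_apply, hz, hz']
  ext z
  simp only [LinearMap.mem_ker, funext_iff, Pi.zero_apply, key]
  exact ⟨fun h i => by simpa using h (σ.symm i), fun h i => h (σ i)⟩

omit [Fintype ι] in
/-- With reindexing, `ψ̃` stays surjective when `φ̃` is. [folklore] -/
private theorem liftBaseChange_funLeft_comp_surjective {A : Type u} [CommRing A] (φ : M →ₗ[ℤ] (Fin k → A))
    (h : Function.Surjective (φ.liftBaseChange A)) :
    Function.Surjective ((LinearMap.funLeft ℤ A σ ∘ₗ φ).liftBaseChange A) := by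
  have key : (LinearMap.funLeft ℤ A σ ∘ₗ φ).liftBaseChange A =
      (LinearMap.funLeft A A σ) ∘ₗ φ.liftBaseChange A := by
    refine TensorProduct.AlgebraTensorModule.ext fun a m => ?_
    rw [LinearMap.liftBaseChange_tmul, LinearMap.comp_apply, LinearMap.comp_apply, LinearMap.liftBaseChange_tmul,
      map_smul]
    rfl
  rw [key, LinearMap.coe_comp]
  exact (LinearEquiv.funCongrLeft A A σ).surjective.comp h

include hq in
/-- **KERNEL OF THE SECTIONS MAP = THE GRASSMANNIAN POINT**: if over the affine open `V` the module `Q` is framed by `e`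
(`σ : ι ≃ Fin k`) and the global sections `q_j` have the TAUTOLOGICAL coordinates `coordMap x (y|_V) (b_j)` — the chart coordinates
of `[1 ⊗ b_j]` in the frame `([1 ⊗ xᵢ])ᵢ` of the quotient `y|_V ∈ G(k, Γ(T, V) ⊗ M)` — then
`ker (θ_V : Γ(T, V) ⊗ M → Γ(Q, V)) = (evalAffine V y).toSubmodule`. [cite: GortzWedhorn2020, (8.4) (pp. 213–215)]
[cite: StacksProject, Tag 089R] -/
theorem ker_sectionsMap_eq_evalAffine :
    LinearMap.ker (sectionsMap b Q q V) = (evalAffine hV y).toSubmodule := by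
  rw [ker_sectionsMap_eq_ker_liftBaseChange b Q q e kV (LinearMap.funLeft ℤ Γ(T, V) σ ∘ₗ coordMap x (evalAffine hV y) hx)
    (fun j => by simpa only [LinearMap.comp_apply, LinearMap.funLeft_apply] using hq j),
    ker_liftBaseChange_funLeft_comp, ker_liftBaseChange_coordMap]

include hq in
/-- Under the tautological relation the sections map `θ_V` is SURJECTIVE (the frame vectors `[1 ⊗ xᵢ]` are hit).
[cite: GortzWedhorn2020, (8.4) (pp. 213–215)] -/
theorem sectionsMap_surjective_of_tautological : Function.Surjective (sectionsMap b Q q V) :=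
  sectionsMap_surjective_of_liftBaseChange_surjective b Q q e kV
    (LinearMap.funLeft ℤ Γ(T, V) σ ∘ₗ coordMap x (evalAffine hV y) hx)
    (fun j => by simpa only [LinearMap.comp_apply, LinearMap.funLeft_apply] using hq j)
    (liftBaseChange_funLeft_comp_surjective σ _ (liftBaseChange_surjective x _ (coordMap_frame x _ hx)))

end Tautological

/-! ## §3 Restriction to a smaller affine open: the tautological coordinates restrict (glue-family form of (B4)) -/

section Restrict

variable {V V' : T.Opens} (hV : IsAffineOpen V) (hV' : IsAffineOpen V') (i : V' ≤ V)
  (y : (grassmannianSheaf M k).obj.obj (op T)) (x : Fin k → M)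
  (hx : evalAffine hV y ∈ chart ℤ M k x Γ(T, V))

include hx i in
/-- Chart membership of the affine evaluations restricts to smaller affine opens. [cite: GortzWedhorn2020, (8.4) (pp. 213–215)] -/
theorem evalAffine_mem_chart_of_le : evalAffine hV' y ∈ chart ℤ M k x Γ(T, V') := by
  rw [evalAffine_of_le hV hV' i]
  exact map_mem_chart _ hx

/-- **The tautological coordinates restrict**: `coordMap x (y|_{V'}) m = (coordMap x (y|_V) m)|_{V'}` for affine opens
`V' ≤ V` (naturality ★ `coordMap_map` along the restriction `Γ(T, V) → Γ(T, V')`).  This is the glue relation of the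
family `(coordMap (b ∘ I) (y|_V) (b_j))_V`. [cite: GortzWedhorn2020, (8.4) (pp. 213–215)] [cite: StacksProject, Tag 089T] -/
theorem coordMap_evalAffine_of_le (hx' : evalAffine hV' y ∈ chart ℤ M k x Γ(T, V')) (m : M) (l : Fin k) :
    coordMap x (evalAffine hV' y) hx' m l = T.presheaf.map (homOfLE i).op (coordMap x (evalAffine hV y) hx m l) := by
  rw [coordMap_congr x (evalAffine_of_le hV hV' i y) hx' (map_mem_chart _ hx), coordMap_map]
  rfl

/-- **The transition matrices restrict**: `g_{xx'}(y|_{V'}) = g_{xx'}(y|_V)|_{V'}` (★ `transition_map`), the `map_g` axiom of a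
★ `Modules.MatrixCocycle`. [cite: Hartshorne1977, II Ex. 5.18 (p. 128)] [cite: StacksProject, Tag 089T] -/
theorem transition_evalAffine_of_le (hx' : evalAffine hV' y ∈ chart ℤ M k x Γ(T, V')) (x' : Fin k → M) :
    (Matrix.of fun l l' => coordMap x (evalAffine hV' y) hx' (x' l') l) =
      (Matrix.of fun l l' => coordMap x (evalAffine hV y) hx (x' l') l).map (T.presheaf.map (homOfLE i).op) := by
  ext l l'
  rw [Matrix.of_apply, Matrix.map_apply, Matrix.of_apply, coordMap_evalAffine_of_le hV hV' i y x hx hx']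

variable {ι : Type u} [Fintype ι] (σ : ι ≃ Fin k) {W : T.Opens} (e : SheafOfModules.free ι ≅ Q.over W) (kV : V ⟶ W)

include hx in
/-- **The tautological relation restricts**: if `q_j|_V = Σᵢ coordMap x (y|_V)(b_j)_{σ i} · eᵢ|_V` then the same holds over
every affine `V' ≤ V`. [cite: GortzWedhorn2020, (8.4) (pp. 213–215)] -/
theorem tautological_of_le (hx' : evalAffine hV' y ∈ chart ℤ M k x Γ(T, V'))
    (hq : ∀ j, Q.presheaf.map (homOfLE le_top).op (q j) =
      ∑ l, coordMap x (evalAffine hV y) hx (b j) (σ l) • Q.presheaf.map kV.op (basisSection e l)) (j : J) :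
    Q.presheaf.map (homOfLE le_top).op (q j) =
      ∑ l, coordMap x (evalAffine hV' y) hx' (b j) (σ l) • Q.presheaf.map (homOfLE i ≫ kV).op (basisSection e l) := by
  have h1 : Q.presheaf.map (homOfLE (le_top : V' ≤ ⊤)).op (q j) =
      Q.presheaf.map (homOfLE i).op (Q.presheaf.map (homOfLE (le_top : V ≤ ⊤)).op (q j)) := by
    rw [presheaf_map_map]
    rfl
  rw [h1, hq j, map_sum]
  refine Finset.sum_congr rfl fun l _ => ?_
  rw [Scheme.Modules.map_smul, presheaf_map_map, coordMap_evalAffine_of_le hV hV' i y x hx hx']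

end Restrict

/-! ## §4 The chart instance: the tautological quotient `(Q, e, q)` on `chartScheme k I = Spec ℤ[X_I]` -/

section Chart

variable (k M) (I : Fin k → J) (hI : Function.Injective I)

/-- On the chart scheme `Spec ℤ[X_I]`, the top evaluation of the universal chart element lies in the chart at the frame `b ∘ I`
(it is the base change of `chartElemAffine ∈ chart` along `ℤ[X_I] ≅ Γ(Spec ℤ[X_I], ⊤)`). [cite: StacksProject, Tag 089T] -/
theorem evalAffine_top_chartElem_eq :
    evalAffine (isAffineOpen_top (chartScheme k I)) (chartElem k M b I hI) =
      Module.Grassmannian.map (Scheme.ΓSpecIso (chartRing k I)).inv.hom.toIntAlgHom (chartElemAffine k M b I hI) := by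
  rw [evalAffine_top, specEquiv_chartElem]

/-- `evalAffine ⊤ (chartElem I) ∈ chart (b ∘ I)`. [cite: StacksProject, Tag 089T] -/
theorem evalAffine_top_chartElem_mem_chart :
    evalAffine (isAffineOpen_top (chartScheme k I)) (chartElem k M b I hI) ∈ chart ℤ M k (⇑b ∘ I) Γ(chartScheme k I, ⊤) :=
  (evalAffine_top_chartElem_eq k M b I hI).symm ▸ map_mem_chart _ (chartElemAffine_mem_chart k M b I hI)

/-- For every affine open `V` of the chart scheme, `evalAffine V (chartElem I) ∈ chart (b ∘ I)`. [cite: StacksProject, Tag 089T] -/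
theorem evalAffine_chartElem_mem_chart {V : (chartScheme k I).Opens} (hV : IsAffineOpen V) :
    evalAffine hV (chartElem k M b I hI) ∈ chart ℤ M k (⇑b ∘ I) Γ(chartScheme k I, V) :=
  evalAffine_mem_chart_of_le (isAffineOpen_top _) hV le_top _ _ (evalAffine_top_chartElem_mem_chart k M b I hI)

/-- **The chart coordinates of the universal chart element are the universal coordinates**: in the frame `b ∘ I`,
`coordMap (evalAffine ⊤ (chartElem I)) m = chartCoordMap I m` read in `Γ(Spec ℤ[X_I], ⊤)` (★ `coordMap_ofCoordMap` + ★ `coordMap_map`).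
[cite: StacksProject, Tag 089T] [cite: EisenbudHarris2016, §3.2.2] -/
theorem coordMap_evalAffine_top_chartElem
    (h : evalAffine (isAffineOpen_top (chartScheme k I)) (chartElem k M b I hI) ∈ chart ℤ M k (⇑b ∘ I) Γ(chartScheme k I, ⊤))
    (m : M) (l : Fin k) :
    coordMap (⇑b ∘ I) (evalAffine (isAffineOpen_top (chartScheme k I)) (chartElem k M b I hI)) h m l =
      (Scheme.ΓSpecIso (chartRing k I)).inv (chartCoordMap k M b I m l) := by
  rw [coordMap_congr (⇑b ∘ I) (evalAffine_top_chartElem_eq k M b I hI) h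
      (map_mem_chart _ (chartElemAffine_mem_chart k M b I hI)),
    coordMap_map _ (⇑b ∘ I) _ (chartElemAffine_mem_chart k M b I hI), LinearMap.comp_apply,
    show coordMap (⇑b ∘ I) (chartElemAffine k M b I hI) (chartElemAffine_mem_chart k M b I hI) = chartCoordMap k M b I from
      coordMap_ofCoordMap _ _ _]
  rfl

variable {k M} (Q₀ : (chartScheme k I).Modules) (q₀ : J → Γ(Q₀, ⊤)) {ι : Type u} [Fintype ι] (σ : ι ≃ Fin k)
  (e : SheafOfModules.free ι ≅ Q₀.over ⊤)
  (hq : ∀ j, q₀ j = ∑ i, (Scheme.ΓSpecIso (chartRing k I)).inv (chartCoordMap k M b I (b j) (σ i)) • basisSection e i)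

include hq in
/-- The hypothesis «`q_j = Σᵢ X-coordinates of b_j · eᵢ`» in the generic tautological form of §2 over `V = ⊤`.
[cite: StacksProject, Tag 089T] -/
theorem tautological_top_chart (j : J) :
    Q₀.presheaf.map (homOfLE le_top).op (q₀ j) =
      ∑ i, coordMap (⇑b ∘ I) (evalAffine (isAffineOpen_top (chartScheme k I)) (chartElem k M b I hI))
        (evalAffine_top_chartElem_mem_chart k M b I hI) (b j) (σ i) • Q₀.presheaf.map (𝟙 ⊤).op (basisSection e i) := by
  have h1 : Q₀.presheaf.map (homOfLE (le_top : (⊤ : (chartScheme k I).Opens) ≤ ⊤)).op (q₀ j) = q₀ j := by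
    rw [show homOfLE (le_top : (⊤ : (chartScheme k I).Opens) ≤ ⊤) = 𝟙 _ from Subsingleton.elim _ _, op_id,
      Q₀.presheaf.map_id]
    rfl
  rw [h1, hq j]
  refine Finset.sum_congr rfl fun i _ => ?_
  rw [coordMap_evalAffine_top_chartElem, op_id, Q₀.presheaf.map_id]
  rfl

include hq in
/-- **(B2) THE KERNEL OF THE TAUTOLOGICAL SECTIONS MAP IS THE UNIVERSAL CHART POINT**: on every affine open `V ⊆ Spec ℤ[X_I]`,
`ker (θ_V : Γ(V) ⊗ M → Γ(Q, V)) = (evalAffine V (chartElem I)).toSubmodule` — for `V = ⊤` this is `chartElemAffine = ker (chartCoordMap ⊗ 1)`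
read in `Γ(Spec ℤ[X_I], ⊤)`. [cite: GortzWedhorn2020, (8.4) (pp. 213–215)] [cite: StacksProject, Tag 089T] -/
theorem ker_sectionsMap_chart {V : (chartScheme k I).Opens} (hV : IsAffineOpen V) :
    LinearMap.ker (sectionsMap b Q₀ q₀ V) = (evalAffine hV (chartElem k M b I hI)).toSubmodule :=
  ker_sectionsMap_eq_evalAffine b Q₀ q₀ σ e (homOfLE le_top ≫ 𝟙 ⊤) hV (chartElem k M b I hI) (⇑b ∘ I)
    (evalAffine_chartElem_mem_chart k M b I hI hV)
    (tautological_of_le b Q₀ q₀ (isAffineOpen_top _) hV le_top (chartElem k M b I hI) (⇑b ∘ I)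
      (evalAffine_top_chartElem_mem_chart k M b I hI) σ e (𝟙 ⊤) (evalAffine_chartElem_mem_chart k M b I hI hV)
      (tautological_top_chart b I hI Q₀ q₀ σ e hq))

include hI hq in
/-- **(B1) THE TAUTOLOGICAL SECTIONS MAPS ARE SURJECTIVE** on every affine open of the chart scheme (the `q_{I i}` are the frame).
[cite: GortzWedhorn2020, (8.4) (pp. 213–215)] -/
theorem sectionsMap_chart_surjective {V : (chartScheme k I).Opens} (hV : IsAffineOpen V) :
    Function.Surjective (sectionsMap b Q₀ q₀ V) :=
  sectionsMap_surjective_of_tautological b Q₀ q₀ σ e (homOfLE le_top ≫ 𝟙 ⊤) hV (chartElem k M b I hI) (⇑b ∘ I)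
    (evalAffine_chartElem_mem_chart k M b I hI hV)
    (tautological_of_le b Q₀ q₀ (isAffineOpen_top _) hV le_top (chartElem k M b I hI) (⇑b ∘ I)
      (evalAffine_top_chartElem_mem_chart k M b I hI) σ e (𝟙 ⊤) (evalAffine_chartElem_mem_chart k M b I hI hV)
      (tautological_top_chart b I hI Q₀ q₀ σ e hq))

variable (k M) [(grassmannianSheaf M k).obj.IsRepresentable]

include hq in
/-- **(B3) THE CLASSIFYING MORPHISM OF THE TAUTOLOGICAL QUOTIENT ON THE CHART IS THE CHART IMMERSION**: a morphism
`f : Spec ℤ[X_I] ⟶ grassmannianScheme M k` induces the kernels of the tautological sections maps on all affine opens (the defining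
property of ★ `existsUnique_hom_ker_sectionsMap` / `existsUnique_hom_of_epi`) iff `f` is the chart immersion
`(pointsEquiv _).symm (chartElem I) = (chartOpenCover k M b).f ⟨I, hI⟩`. [cite: GortzWedhorn2020, (8.4) (pp. 213–215)]
[cite: StacksProject, Tag 089T] -/
theorem classify_chart_iff (f : chartScheme k I ⟶ grassmannianScheme M k) :
    (∀ V : (chartScheme k I).affineOpens,
        (evalAffine V.2 (pointsEquiv M k _ f)).toSubmodule = LinearMap.ker (sectionsMap b Q₀ q₀ V)) ↔
      f = (pointsEquiv M k (chartScheme k I)).symm (chartElem k M b I hI) := by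
  constructor
  · intro h
    refine hom_ext_of_evalAffine M k fun V hV => ?_
    rw [Equiv.apply_symm_apply]
    exact Module.Grassmannian.ext ((h ⟨V, hV⟩).trans (ker_sectionsMap_chart b I hI Q₀ q₀ σ e hq hV))
  · rintro rfl V
    rw [Equiv.apply_symm_apply, ker_sectionsMap_chart b I hI Q₀ q₀ σ e hq V.2]

include hI hq in
/-- (B3), `∃!` form: the chart immersion is THE morphism classifying the tautological quotient on `Spec ℤ[X_I]`.
[cite: GortzWedhorn2020, (8.4) (pp. 213–215)] -/
theorem existsUnique_classify_chart :
    ∃! f : chartScheme k I ⟶ grassmannianScheme M k, ∀ V : (chartScheme k I).affineOpens,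
      (evalAffine V.2 (pointsEquiv M k _ f)).toSubmodule = LinearMap.ker (sectionsMap b Q₀ q₀ V) :=
  ⟨(pointsEquiv M k (chartScheme k I)).symm (chartElem k M b I hI),
    (classify_chart_iff k M b I hI Q₀ q₀ σ e hq _).2 rfl, fun f hf => (classify_chart_iff k M b I hI Q₀ q₀ σ e hq f).1 hf⟩

end Chart

/-! ## §5 (B0) The overlap of two charts is the basic open of the determinant of the universal transition matrix -/

section Overlap

variable (k M)

/-- **`chartLocus (b ∘ I) (chartElem I′) = D(det g_{I′I}) ⊆ Spec ℤ[X_{I′}]`** for the universal transition matrix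
`g_{I′I} = (chartCoordMap I′ (b (I l′)) l)_{l l′} ∈ M_k(ℤ[X_{I′}])`: at a point `q` the residue-field value of the universal chart
point lies in the chart `b ∘ I` iff `det g_{I′I}` is a unit in `κ(q)` (★ FILE A `mem_chart_iff_isUnit_det_transition`,
`det_transition_map`; the rank-one case is ★ `chartLocus_one_chartElem_eq_basicOpen`). [cite: GortzWedhorn2020, (8.4) (pp. 213–215)]
[cite: StacksProject, Tag 089T] -/
theorem chartLocus_chartElem_eq_basicOpen_det (I I' : Fin k → J) (hI' : Function.Injective I') :
    chartLocus (⇑b ∘ I) (chartElem k M b I' hI') =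
      PrimeSpectrum.basicOpen (Matrix.of fun l l' => chartCoordMap k M b I' (b (I l')) l).det := by
  ext q
  change q ∈ chartLocus _ _ ↔ q ∈ PrimeSpectrum.basicOpen _
  rw [mem_chartLocus_iff_of_isAffine, evalAffine_top, specEquiv_chartElem, ← Module.Grassmannian.map_comp]
  set φ : (chartRing k I') →ₐ[ℤ] (chartScheme k I').residueField q :=
    ((chartScheme k I').Γevaluation q).hom.toIntAlgHom.comp
      (Scheme.ΓSpecIso (chartRing k I')).inv.hom.toIntAlgHom with hφ
  have hmem := chartElemAffine_mem_chart k M b I' hI'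
  rw [mem_chart_iff_isUnit_det_transition (⇑b ∘ I') (⇑b ∘ I) _ (map_mem_chart φ hmem),
    det_transition_map φ (⇑b ∘ I') (⇑b ∘ I) _ hmem,
    show coordMap (⇑b ∘ I') (chartElemAffine k M b I' hI') hmem = chartCoordMap k M b I' from coordMap_ofCoordMap _ _ _]
  change IsUnit ((chartScheme k I').Γevaluation q
    ((Scheme.ΓSpecIso (chartRing k I')).inv (Matrix.of fun l l' => chartCoordMap k M b I' (b (I l')) l).det)) ↔ _
  rw [isUnit_iff_ne_zero, Scheme.evaluation_ne_zero_iff_mem_basicOpen, ← basicOpen_eq_of_affine]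

variable [(grassmannianSheaf M k).obj.IsRepresentable]

/-- **(B0) THE OVERLAP OF TWO CHARTS, PULLED BACK TO A CHART, IS THE BASIC OPEN `D(det g_{I′I})`** of the determinant of the
universal transition matrix: `ι_{I′}⁻¹(U_I) = D(det (chartCoordMap I′ (b (I l′)) l)_{l l′}) ⊆ Spec ℤ[X_{I′}]`.
[cite: GortzWedhorn2020, (8.4) (pp. 213–215)] [cite: StacksProject, Tag 089T] -/
theorem preimage_opensRange_chartι_eq_basicOpen_det (I I' : {I : Fin k → J // Function.Injective I}) :
    (chartOpenCover k M b).f I' ⁻¹ᵁ ((chartOpenCover k M b).f I).opensRange =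
      PrimeSpectrum.basicOpen (Matrix.of fun l l' => chartCoordMap k M b I'.1 (b (I.1 l')) l).det := by
  rw [preimage_opensRange_chartι]
  exact chartLocus_chartElem_eq_basicOpen_det k M b I.1 I'.1 I'.2

/-- **The pairwise overlaps `U_I ∩ U_{I′}` of the standard open cover of the Grassmannian scheme are AFFINE** (the image under the
open immersion `ι_{I′}` of the basic open `D(det g_{I′I})` of the affine chart). [cite: GortzWedhorn2020, (8.4) (pp. 213–215)]
[cite: StacksProject, Tag 089T] -/
theorem isAffineOpen_opensRange_inf_opensRange (I I' : {I : Fin k → J // Function.Injective I}) :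
    IsAffineOpen (((chartOpenCover k M b).f I').opensRange ⊓ ((chartOpenCover k M b).f I).opensRange) := by
  rw [← Scheme.Hom.image_preimage_eq_opensRange_inf, preimage_opensRange_chartι_eq_basicOpen_det,
    ← basicOpen_eq_of_affine]
  exact ((isAffineOpen_top (Spec (chartRing k I'.1))).basicOpen _).image_of_isOpenImmersion ((chartOpenCover k M b).f I')

end Overlap

end Literature.AlgebraicGeometry.Motives.Grassmannian
end
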